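import Summits.Parity.BatemanHorn.Theorems.SoloInformedTwinUnbalancedBilinear

/-!
# The unbalanced twin sum — VIII: both regimes (the full bound, file F5a)

Soloist file (informed mode), kernel project for (F′).  We glue regime (1a) (small cofactors
`k ≤ K₀`, `SoloInformedTwinUnbalancedSmall` + Bombieri–Vinogradov for `μ`) and regime (1b)
(large cofactors `K₀ < k ≤ K`, `SoloInformedTwinUnbalancedBilinear`, Bombieri–Friedlander–Iwaniec):
for one switched configuration `∑_{q ≤ z} |S(lo,hi;q,r₀,a)(w_q)| ≤ C X (log X)^{-A}` under the
regime-(1a) conditions for `K₀` only (`sum_abs_switchedSum_twinSwitchWeight_le_full`), and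
`|U(x; y, z)| ≤ C x (log x)^{-A}` for the four twin configurations
(`abs_twinUnbalancedSum_le_full`).  The asymptotic choice of parameters is file F5b.
-/

namespace Summit.Parity.BatemanHorn.Theorems

open Finset Real
open scoped ArithmeticFunction.Moebius

/-! ### 1. Splitting the cofactor range at `K₀` -/

/-- `∑_q |∑_{k ≤ K}| ≤ S + T` from a bound `S` for the cofactors `k ≤ min K K₀` and a bound `T`
for `K₀ < k ≤ K` (needed only when `K₀ < K`). -/
theorem sum_abs_cofactor_split_le (j r₀ lo hi y z K₀ K : ℕ) (a : ℤ) {S T : ℝ}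
    (hS : ∑ q ∈ Icc 1 z, |∑ k ∈ Icc 1 (min K K₀),
        (if k.Coprime r₀ then (1 : ℝ) else 0) * innerP j r₀ lo hi y a q k| ≤ S)
    (hT0 : 0 ≤ T)
    (hT : K₀ < K → ∑ q ∈ Icc 1 z, |∑ k ∈ Ioc K₀ K,
        (if k.Coprime r₀ then (1 : ℝ) else 0) * innerP j r₀ lo hi y a q k| ≤ T) :
    ∑ q ∈ Icc 1 z, |∑ k ∈ Icc 1 K,
        (if k.Coprime r₀ then (1 : ℝ) else 0) * innerP j r₀ lo hi y a q k| ≤ S + T := by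
  set K₁ := min K K₀ with hK₁
  have hsplit : ∀ q, ∑ k ∈ Icc 1 K, (if k.Coprime r₀ then (1 : ℝ) else 0) * innerP j r₀ lo hi y a q k
      = ∑ k ∈ Icc 1 K₁, (if k.Coprime r₀ then (1 : ℝ) else 0) * innerP j r₀ lo hi y a q k
        + ∑ k ∈ Ioc K₁ K, (if k.Coprime r₀ then (1 : ℝ) else 0) * innerP j r₀ lo hi y a q k := by
    intro q
    rw [← sum_filter_add_sum_filter_not (Icc 1 K) (fun k => k ≤ K₁)]
    congr 1
    · congr 1; ext k; simp only [mem_filter, mem_Icc]; omega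
    · congr 1; ext k; simp only [mem_filter, mem_Icc, mem_Ioc]; omega
  have hlarge : ∑ q ∈ Icc 1 z, |∑ k ∈ Ioc K₁ K,
      (if k.Coprime r₀ then (1 : ℝ) else 0) * innerP j r₀ lo hi y a q k| ≤ T := by
    rcases lt_or_ge K₀ K with h | h
    · have : K₁ = K₀ := by rw [hK₁]; omega
      rw [this]; exact hT h
    · have : K₁ = K := by rw [hK₁]; omega
      rw [this]
      simpa using hT0
  calc ∑ q ∈ Icc 1 z, |∑ k ∈ Icc 1 K,
          (if k.Coprime r₀ then (1 : ℝ) else 0) * innerP j r₀ lo hi y a q k|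
      ≤ ∑ q ∈ Icc 1 z, (|∑ k ∈ Icc 1 K₁,
            (if k.Coprime r₀ then (1 : ℝ) else 0) * innerP j r₀ lo hi y a q k|
          + |∑ k ∈ Ioc K₁ K, (if k.Coprime r₀ then (1 : ℝ) else 0) * innerP j r₀ lo hi y a q k|) := by
        refine sum_le_sum fun q _ => ?_
        rw [hsplit q]; exact abs_add_le _ _
    _ ≤ S + T := by rw [sum_add_distrib]; exact add_le_add hS hlarge

/-! ### 2. One switched sum over the moduli `q ≤ z`, both regimes -/

/-- For one admissible configuration `(lo, hi, r₀, a)`, `0 < ε' ≤ 1/8` and `A > 0`: there are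
`B > 0`, `C ≥ 0`, `X₀` with `∑_{q ≤ z} |S(lo,hi;q,r₀,a)(w_q)| ≤ C X (log X)^{-A}` whenever
`X ≥ X₀`, `1 ≤ lo ≤ K₀ + 1`, `0 < hi ≤ X`, `1 ≤ z`, `y ≤ X`, `hi·z ≤ (K+1)·y`, `K₀` is in regime
(1a) (`K₀ (2z (log X)^B)² ≤ hi`, `K₀ X^{1/2} ≤ hi`), `X^{4ε'} ≤ K₀`, `z² (log X)^B ≤ y` and
`2z X^{ε'} ≤ y`.  No condition on `K` beyond the truncation. -/
theorem sum_abs_switchedSum_twinSwitchWeight_le_full {r₀ : ℕ} {a : ℤ}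
    (hfam : r₀ = 1 ∨ (r₀ = 2 ∧ (2 : ℤ) ∣ a)) (ha : ∀ q : ℕ, q.Coprime r₀ → IsCoprime (q : ℤ) a)
    {ε' : ℝ} (hε' : 0 < ε') (hε'1 : ε' ≤ 1 / 8) (A : ℝ) (hA : 0 < A) :
    ∃ B C X₀ : ℝ, 0 < B ∧ 0 ≤ C ∧ ∀ X : ℝ, X₀ ≤ X → ∀ lo hi y z K₀ K : ℕ, 1 ≤ lo →
      lo ≤ K₀ + 1 → 0 < hi → (hi : ℝ) ≤ X → 1 ≤ z → (y : ℝ) ≤ X → hi * z ≤ (K + 1) * y →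
      (K₀ : ℝ) * (2 * z * Real.log X ^ B) ^ 2 ≤ hi → (K₀ : ℝ) * X ^ (1 / 2 : ℝ) ≤ hi →
      X ^ (4 * ε') ≤ K₀ → (z : ℝ) ^ 2 * Real.log X ^ B ≤ y → 2 * z * X ^ ε' ≤ (y : ℝ) →
      ∑ q ∈ Icc 1 z, |switchedSum lo hi q r₀ a (twinSwitchWeight y q)|
        ≤ C * X / Real.log X ^ A := by
  have hA2 : 0 < A + 2 := by linarith
  obtain ⟨B₀, C₀, X₀, hB₀, hC₀, h₀⟩ := sum_abs_innerP_small_le_base 0 hfam ha (A + 2) hA2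
  obtain ⟨B₁, C₁, X₁, hB₁, hC₁, h₁⟩ := sum_abs_innerP_small_le_base 1 hfam ha (A + 2) hA2
  obtain ⟨B₂, C₂, X₂, hB₂, hC₂, h₂⟩ := sum_abs_innerP_small_le_base 2 hfam ha (A + 2) hA2
  obtain ⟨D₀, E₀, Y₀, hE₀, g₀⟩ := sum_abs_innerP_large_le 0 hfam ha hε' hε'1 (A + 2) hA2
  obtain ⟨D₁, E₁, Y₁, hE₁, g₁⟩ := sum_abs_innerP_large_le 1 hfam ha hε' hε'1 (A + 2) hA2
  obtain ⟨D₂, E₂, Y₂, hE₂, g₂⟩ := sum_abs_innerP_large_le 2 hfam ha hε' hε'1 (A + 2) hA2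
  set B : ℝ := max (max B₀ (max B₁ B₂)) (max (D₀ : ℝ) (max (D₁ : ℝ) (D₂ : ℝ))) with hBdef
  refine ⟨B, C₀ + C₁ + C₂ + (E₀ + E₁ + E₂),
    max (max (max X₀ (max X₁ X₂)) (max Y₀ (max Y₁ Y₂))) 9,
    lt_max_of_lt_left (lt_max_of_lt_left hB₀), by positivity, ?_⟩
  intro X hX lo hi y z K₀ K hlo hloK hhi hhiX hz hyX hKy hK1 hK2 hK₀ hzy hzε
  have hX9 : 9 ≤ X := le_trans (le_max_right _ _) hX
  have hX' : max (max X₀ (max X₁ X₂)) (max Y₀ (max Y₁ Y₂)) ≤ X := le_trans (le_max_left _ _) hX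
  have hXs : max X₀ (max X₁ X₂) ≤ X := le_trans (le_max_left _ _) hX'
  have hXl : max Y₀ (max Y₁ Y₂) ≤ X := le_trans (le_max_right _ _) hX'
  have hX₀ : X₀ ≤ X := le_trans (le_max_left _ _) hXs
  have hX₁ : X₁ ≤ X := le_trans (le_trans (le_max_left _ _) (le_max_right _ _)) hXs
  have hX₂ : X₂ ≤ X := le_trans (le_trans (le_max_right _ _) (le_max_right _ _)) hXs
  have hY₀ : Y₀ ≤ X := le_trans (le_max_left _ _) hXl
  have hY₁ : Y₁ ≤ X := le_trans (le_trans (le_max_left _ _) (le_max_right _ _)) hXl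
  have hY₂ : Y₂ ≤ X := le_trans (le_trans (le_max_right _ _) (le_max_right _ _)) hXl
  have hL2 : 2 ≤ Real.log X := two_le_log_of_nine_le hX9
  have hL0 : 0 < Real.log X := by linarith
  have hL1 : 1 ≤ Real.log X := by linarith
  -- regime (1a) for `K₁ = min K K₀` with each `B_j ≤ B`
  have hK₁K₀ : ((min K K₀ : ℕ) : ℝ) ≤ K₀ := by exact_mod_cast min_le_right K K₀
  have hreg : ∀ B' : ℝ, B' ≤ B → ((min K K₀ : ℕ) : ℝ) * (2 * z * Real.log X ^ B') ^ 2 ≤ hi := by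
    intro B' hB'
    refine le_trans ?_ hK1
    have hpow : Real.log X ^ B' ≤ Real.log X ^ B := Real.rpow_le_rpow_of_exponent_le hL1 hB'
    have h0' : 0 ≤ 2 * (z : ℝ) * Real.log X ^ B' :=
      mul_nonneg (by positivity) (Real.rpow_nonneg hL0.le _)
    exact mul_le_mul hK₁K₀
      (pow_le_pow_left₀ h0' (mul_le_mul_of_nonneg_left hpow (by positivity)) 2)
      (by positivity) (Nat.cast_nonneg K₀)
  have hreg' : ((min K K₀ : ℕ) : ℝ) * X ^ (1 / 2 : ℝ) ≤ hi :=
    le_trans (mul_le_mul_of_nonneg_right hK₁K₀ (Real.rpow_nonneg (by linarith) _)) hK2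
  -- the level condition of regime (1b) with each `D_j ≤ B`
  have hlev : ∀ D : ℕ, (D : ℝ) ≤ B → (z : ℝ) ^ 2 * Real.log X ^ D ≤ y := by
    intro D hD
    refine le_trans ?_ hzy
    have hpow : Real.log X ^ (D : ℝ) ≤ Real.log X ^ B := Real.rpow_le_rpow_of_exponent_le hL1 hD
    rw [Real.rpow_natCast] at hpow
    exact mul_le_mul_of_nonneg_left hpow (by positivity)
  have hB₀le : B₀ ≤ B := le_trans (le_max_left _ _) (le_max_left _ _)
  have hB₁le : B₁ ≤ B :=
    le_trans (le_trans (le_max_left _ _) (le_max_right _ _)) (le_max_left _ _)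
  have hB₂le : B₂ ≤ B :=
    le_trans (le_trans (le_max_right _ _) (le_max_right _ _)) (le_max_left _ _)
  have hD₀le : (D₀ : ℝ) ≤ B := le_trans (le_max_left _ _) (le_max_right _ _)
  have hD₁le : (D₁ : ℝ) ≤ B :=
    le_trans (le_trans (le_max_left _ _) (le_max_right _ _)) (le_max_right _ _)
  have hD₂le : (D₂ : ℝ) ≤ B :=
    le_trans (le_trans (le_max_right _ _) (le_max_right _ _)) (le_max_right _ _)
  -- the truncated cofactor sums, both regimes
  have hT : ∀ j, ∀ q ∈ Icc 1 z, switchedSum lo hi q r₀ a (moebiusLogCut y q j)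
      = ∑ k ∈ Icc 1 K, (if k.Coprime r₀ then (1 : ℝ) else 0) * innerP j r₀ lo hi y a q k := by
    intro j q hq
    rw [mem_Icc] at hq
    rw [switchedSum_moebiusLogCut_eq_sum_innerP hq.1 hlo,
      sum_indicator_innerP_eq_trunc hq.1 hq.2 hKy]
  have hXA : 0 ≤ X / Real.log X ^ (A + 2) := by
    have := Real.rpow_pos_of_pos hL0 (A + 2); positivity
  have hS0 := sum_abs_cofactor_split_le 0 r₀ lo hi y z K₀ K a
    (h₀ X hX₀ lo hi y z (min K K₀) hhiX (hreg B₀ hB₀le) hreg')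
    (by have := mul_nonneg hE₀ hXA; simpa [mul_div_assoc] using this)
    (fun _ => g₀ X hY₀ lo hi y z K₀ K hhi hhiX hloK hK₀ hz hyX (hlev D₀ hD₀le) hzε)
  have hS1 := sum_abs_cofactor_split_le 1 r₀ lo hi y z K₀ K a
    (h₁ X hX₁ lo hi y z (min K K₀) hhiX (hreg B₁ hB₁le) hreg')
    (by have := mul_nonneg hE₁ hXA; simpa [mul_div_assoc] using this)
    (fun _ => g₁ X hY₁ lo hi y z K₀ K hhi hhiX hloK hK₀ hz hyX (hlev D₁ hD₁le) hzε)
  have hS2 := sum_abs_cofactor_split_le 2 r₀ lo hi y z K₀ K a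
    (h₂ X hX₂ lo hi y z (min K K₀) hhiX (hreg B₂ hB₂le) hreg')
    (by have := mul_nonneg hE₂ hXA; simpa [mul_div_assoc] using this)
    (fun _ => g₂ X hY₂ lo hi y z K₀ K hhi hhiX hloK hK₀ hz hyX (hlev D₂ hD₂le) hzε)
  have hzX : (z : ℝ) ≤ X := by
    have hz' : (1 : ℝ) ≤ z := by exact_mod_cast hz
    have hBpos : 0 < B := lt_max_of_lt_left (lt_max_of_lt_left hB₀)
    have hLB : 1 ≤ Real.log X ^ B := Real.one_le_rpow hL1 hBpos.le
    have h1 : (z : ℝ) ≤ (z : ℝ) ^ 2 * Real.log X ^ B := by nlinarith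
    exact (h1.trans hzy).trans hyX
  -- per modulus: the weight costs `(log X)²`
  have hq_le : ∀ q ∈ Icc 1 z, |switchedSum lo hi q r₀ a (twinSwitchWeight y q)|
      ≤ Real.log X ^ 2 *
        (|∑ k ∈ Icc 1 K, (if k.Coprime r₀ then (1 : ℝ) else 0) * innerP 0 r₀ lo hi y a q k|
        + |∑ k ∈ Icc 1 K, (if k.Coprime r₀ then (1 : ℝ) else 0) * innerP 1 r₀ lo hi y a q k|
        + |∑ k ∈ Icc 1 K, (if k.Coprime r₀ then (1 : ℝ) else 0) * innerP 2 r₀ lo hi y a q k|) := by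
    intro q hq
    have hq' := hq
    rw [mem_Icc] at hq'
    have hqX : (q : ℝ) ≤ X := le_trans (by exact_mod_cast hq'.2) hzX
    rw [← hT 0 q hq, ← hT 1 q hq, ← hT 2 q hq]
    exact abs_switchedSum_twinSwitchWeight_le_logSq hq'.1 hqX hX9 lo hi r₀ y a
  have hsplit : Real.log X ^ (A + 2) = Real.log X ^ A * Real.log X ^ 2 := by
    rw [Real.rpow_add hL0, show (2 : ℝ) = ((2 : ℕ) : ℝ) by norm_num, Real.rpow_natCast]
  have hLA : 0 < Real.log X ^ A := Real.rpow_pos_of_pos hL0 _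
  calc ∑ q ∈ Icc 1 z, |switchedSum lo hi q r₀ a (twinSwitchWeight y q)|
      ≤ ∑ q ∈ Icc 1 z, Real.log X ^ 2 *
        (|∑ k ∈ Icc 1 K, (if k.Coprime r₀ then (1 : ℝ) else 0) * innerP 0 r₀ lo hi y a q k|
        + |∑ k ∈ Icc 1 K, (if k.Coprime r₀ then (1 : ℝ) else 0) * innerP 1 r₀ lo hi y a q k|
        + |∑ k ∈ Icc 1 K, (if k.Coprime r₀ then (1 : ℝ) else 0) * innerP 2 r₀ lo hi y a q k|) :=
        sum_le_sum hq_le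
    _ = Real.log X ^ 2 *
        (∑ q ∈ Icc 1 z,
            |∑ k ∈ Icc 1 K, (if k.Coprime r₀ then (1 : ℝ) else 0) * innerP 0 r₀ lo hi y a q k|
          + ∑ q ∈ Icc 1 z,
            |∑ k ∈ Icc 1 K, (if k.Coprime r₀ then (1 : ℝ) else 0) * innerP 1 r₀ lo hi y a q k|
          + ∑ q ∈ Icc 1 z,
            |∑ k ∈ Icc 1 K, (if k.Coprime r₀ then (1 : ℝ) else 0) * innerP 2 r₀ lo hi y a q k|) := by
        rw [← mul_sum, sum_add_distrib, sum_add_distrib]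
    _ ≤ Real.log X ^ 2 * ((C₀ * X / Real.log X ^ (A + 2) + E₀ * X / Real.log X ^ (A + 2))
          + (C₁ * X / Real.log X ^ (A + 2) + E₁ * X / Real.log X ^ (A + 2))
          + (C₂ * X / Real.log X ^ (A + 2) + E₂ * X / Real.log X ^ (A + 2))) :=
        mul_le_mul_of_nonneg_left (add_le_add_three hS0 hS1 hS2) (by positivity)
    _ = (C₀ + C₁ + C₂ + (E₀ + E₁ + E₂)) * X / Real.log X ^ A := by
        rw [hsplit]
        field_simp
        ring

/-! ### 3. The four configurations: `|U(x; y, z)|` -/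

/-- **The unbalanced twin sum, both regimes.**  For `0 < ε' ≤ 1/8` and every `A > 0` there are
`B > 0`, `C ≥ 0`, `X₀` such that `|U(x; y, z)| ≤ C x (log x)^{-A}` whenever `x ≥ X₀`, `z² ≤ y ≤ x`,
`1 ≤ z ≤ x`, `(x+2)·z ≤ (K+1)·y`, `2 ≤ K₀`, `K₀ (2z (log(x+2))^B)² ≤ ⌊x/2⌋`,
`K₀ (x+2)^{1/2} ≤ ⌊x/2⌋`, `(x+2)^{4ε'} ≤ K₀`, `z² (log(x+2))^B ≤ y` and `2z (x+2)^{ε'} ≤ y`. -/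
theorem abs_twinUnbalancedSum_le_full {ε' : ℝ} (hε' : 0 < ε') (hε'1 : ε' ≤ 1 / 8) (A : ℝ)
    (hA : 0 < A) :
    ∃ B C X₀ : ℝ, 0 < B ∧ 0 ≤ C ∧ ∀ x y z K₀ K : ℕ, X₀ ≤ (x : ℝ) → z * z ≤ y → y ≤ x → 1 ≤ z →
      z ≤ x → (x + 2) * z ≤ (K + 1) * y → 2 ≤ K₀ →
      (K₀ : ℝ) * (2 * z * Real.log ((x : ℝ) + 2) ^ B) ^ 2 ≤ ((x / 2 : ℕ) : ℝ) →
      (K₀ : ℝ) * ((x : ℝ) + 2) ^ (1 / 2 : ℝ) ≤ ((x / 2 : ℕ) : ℝ) →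
      ((x : ℝ) + 2) ^ (4 * ε') ≤ K₀ → (z : ℝ) ^ 2 * Real.log ((x : ℝ) + 2) ^ B ≤ y →
      2 * z * ((x : ℝ) + 2) ^ ε' ≤ (y : ℝ) →
      |twinUnbalancedSum x y z| ≤ C * x / Real.log x ^ A := by
  have ha2 : ∀ q : ℕ, q.Coprime 2 → IsCoprime (q : ℤ) 2 := fun q hq =>
    (Nat.isCoprime_iff_coprime.mpr hq : IsCoprime (q : ℤ) ((2 : ℕ) : ℤ))
  have ha2' : ∀ q : ℕ, q.Coprime 2 → IsCoprime (q : ℤ) (-2) := fun q hq => (ha2 q hq).neg_right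
  have ha1 : ∀ q : ℕ, q.Coprime 1 → IsCoprime (q : ℤ) 1 := fun q _ => isCoprime_one_right
  have ha1' : ∀ q : ℕ, q.Coprime 1 → IsCoprime (q : ℤ) (-1) := fun q _ =>
    isCoprime_one_right.neg_right
  obtain ⟨B₁, C₁, X₁, hB₁, hC₁, h₁⟩ := sum_abs_switchedSum_twinSwitchWeight_le_full
    (r₀ := 2) (a := 2) (Or.inr ⟨rfl, dvd_rfl⟩) ha2 hε' hε'1 A hA
  obtain ⟨B₂, C₂, X₂, hB₂, hC₂, h₂⟩ := sum_abs_switchedSum_twinSwitchWeight_le_full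
    (r₀ := 1) (a := 1) (Or.inl rfl) ha1 hε' hε'1 A hA
  obtain ⟨B₃, C₃, X₃, hB₃, hC₃, h₃⟩ := sum_abs_switchedSum_twinSwitchWeight_le_full
    (r₀ := 2) (a := -2) (Or.inr ⟨rfl, ⟨-1, by norm_num⟩⟩) ha2' hε' hε'1 A hA
  obtain ⟨B₄, C₄, X₄, hB₄, hC₄, h₄⟩ := sum_abs_switchedSum_twinSwitchWeight_le_full
    (r₀ := 1) (a := -1) (Or.inl rfl) ha1' hε' hε'1 A hA
  set B : ℝ := max (max B₁ B₂) (max B₃ B₄) with hBdef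
  refine ⟨B, 3 * (C₁ + C₂ + C₃ + C₄), max (max (max X₁ X₂) (max X₃ X₄)) 9,
    lt_max_of_lt_left (lt_max_of_lt_left hB₁), by positivity, ?_⟩
  intro x y z K₀ K hx hzy hyx hz hzx hKy hK₀2 hK1 hK2 hK₀ hzlev hzε
  have hx9 : (9 : ℝ) ≤ x := le_trans (le_max_right _ _) hx
  have hx' : max (max X₁ X₂) (max X₃ X₄) ≤ (x : ℝ) := le_trans (le_max_left _ _) hx
  set X : ℝ := (x : ℝ) + 2 with hXdef
  have hxX : (x : ℝ) ≤ X := by rw [hXdef]; linarith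
  have hX₁ : X₁ ≤ X := le_trans (le_trans (le_max_left _ _) (le_max_left _ _)) (hx'.trans hxX)
  have hX₂ : X₂ ≤ X := le_trans (le_trans (le_max_right _ _) (le_max_left _ _)) (hx'.trans hxX)
  have hX₃ : X₃ ≤ X := le_trans (le_trans (le_max_left _ _) (le_max_right _ _)) (hx'.trans hxX)
  have hX₄ : X₄ ≤ X := le_trans (le_trans (le_max_right _ _) (le_max_right _ _)) (hx'.trans hxX)
  have hX9 : 9 ≤ X := hx9.trans hxX
  have hLX2 : 2 ≤ Real.log X := two_le_log_of_nine_le hX9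
  have hLX0 : 0 < Real.log X := by linarith
  have hLX1 : 1 ≤ Real.log X := by linarith
  have hyX : (y : ℝ) ≤ X := le_trans (by exact_mod_cast hyx) hxX
  -- the four `hi`'s: `x/2 ≤ hi ≤ x + 2`, all positive
  have hhalf_le : ((x / 2 : ℕ) : ℝ) ≤ x := by exact_mod_cast Nat.div_le_self x 2
  have hhi1 : ((x + 2 : ℕ) : ℝ) ≤ X := by rw [hXdef]; push_cast; exact le_rfl
  have hhi2 : ((x / 2 + 1 : ℕ) : ℝ) ≤ X := by rw [hXdef]; push_cast; linarith
  have hhi3 : ((x : ℕ) : ℝ) ≤ X := hxX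
  have hhi4 : ((x / 2 : ℕ) : ℝ) ≤ X := hhalf_le.trans hxX
  have hx9' : 9 ≤ x := by exact_mod_cast hx9
  have hp1 : 0 < x + 2 := by omega
  have hp2 : 0 < x / 2 + 1 := by omega
  have hp3 : 0 < x := by omega
  have hp4 : 0 < x / 2 := by omega
  have hlo1 : ((x / 2 : ℕ) : ℝ) ≤ ((x + 2 : ℕ) : ℝ) := by
    exact_mod_cast (Nat.div_le_self x 2).trans (Nat.le_add_right x 2)
  have hlo2 : ((x / 2 : ℕ) : ℝ) ≤ ((x / 2 + 1 : ℕ) : ℝ) := by exact_mod_cast Nat.le_succ _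
  have hlo3 : ((x / 2 : ℕ) : ℝ) ≤ ((x : ℕ) : ℝ) := hhalf_le
  have hl3 : 3 ≤ K₀ + 1 := by omega
  have hl2 : 2 ≤ K₀ + 1 := by omega
  have hl1 : 1 ≤ K₀ + 1 := by omega
  -- the truncation hypotheses `hi·z ≤ (K+1)·y`
  have hKy1 : (x + 2) * z ≤ (K + 1) * y := hKy
  have hKy2 : (x / 2 + 1) * z ≤ (K + 1) * y :=
    le_trans (Nat.mul_le_mul_right z (by omega)) hKy
  have hKy3 : x * z ≤ (K + 1) * y := le_trans (Nat.mul_le_mul_right z (by omega)) hKy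
  have hKy4 : (x / 2) * z ≤ (K + 1) * y :=
    le_trans (Nat.mul_le_mul_right z ((Nat.div_le_self x 2).trans (by omega))) hKy
  -- the regime / level conditions with each `B_i ≤ B` and each `hi ≥ x/2`
  have hpowB : ∀ B' : ℝ, B' ≤ B → Real.log X ^ B' ≤ Real.log X ^ B := fun B' hB' =>
    Real.rpow_le_rpow_of_exponent_le hLX1 hB'
  have hreg : ∀ B' : ℝ, B' ≤ B → ∀ {h : ℝ}, ((x / 2 : ℕ) : ℝ) ≤ h →
      (K₀ : ℝ) * (2 * z * Real.log X ^ B') ^ 2 ≤ h := by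
    intro B' hB' h hh
    refine le_trans ?_ (hK1.trans hh)
    have h0' : 0 ≤ 2 * (z : ℝ) * Real.log X ^ B' :=
      mul_nonneg (by positivity) (Real.rpow_nonneg hLX0.le _)
    exact mul_le_mul_of_nonneg_left
      (pow_le_pow_left₀ h0' (mul_le_mul_of_nonneg_left (hpowB B' hB') (by positivity)) 2)
      (Nat.cast_nonneg K₀)
  have hreg' : ∀ {h : ℝ}, ((x / 2 : ℕ) : ℝ) ≤ h → (K₀ : ℝ) * X ^ (1 / 2 : ℝ) ≤ h :=
    fun hh => hK2.trans hh
  have hlev : ∀ B' : ℝ, B' ≤ B → (z : ℝ) ^ 2 * Real.log X ^ B' ≤ y := fun B' hB' =>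
    le_trans (mul_le_mul_of_nonneg_left (hpowB B' hB') (by positivity)) hzlev
  have hB₁le : B₁ ≤ B := le_trans (le_max_left _ _) (le_max_left _ _)
  have hB₂le : B₂ ≤ B := le_trans (le_max_right _ _) (le_max_left _ _)
  have hB₃le : B₃ ≤ B := le_trans (le_max_left _ _) (le_max_right _ _)
  have hB₄le : B₄ ≤ B := le_trans (le_max_right _ _) (le_max_right _ _)
  have hS1 := h₁ X hX₁ 3 (x + 2) y z K₀ K (by norm_num) hl3 hp1 hhi1 hz hyX hKy1
    (hreg B₁ hB₁le hlo1) (hreg' hlo1) hK₀ (hlev B₁ hB₁le) hzε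
  have hS2 := h₂ X hX₂ 2 (x / 2 + 1) y z K₀ K (by norm_num) hl2 hp2 hhi2 hz hyX hKy2
    (hreg B₂ hB₂le hlo2) (hreg' hlo2) hK₀ (hlev B₂ hB₂le) hzε
  have hS3 := h₃ X hX₃ 1 x y z K₀ K le_rfl hl1 hp3 hhi3 hz hyX hKy3 (hreg B₃ hB₃le hlo3)
    (hreg' hlo3) hK₀ (hlev B₃ hB₃le) hzε
  have hS4 := h₄ X hX₄ 1 (x / 2) y z K₀ K le_rfl hl1 hp4 hhi4 hz hyX hKy4 (hreg B₄ hB₄le le_rfl)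
    (hreg' le_rfl) hK₀ (hlev B₄ hB₄le) hzε
  -- `|U| ≤` the four sums over `q ≤ z`
  rw [twinUnbalancedSum_eq_switched hzy x]
  set F : ℕ → ℝ := fun q => switchedSum 3 (x + 2) q 2 2 (twinSwitchWeight y q)
      + switchedSum 2 (x / 2 + 1) q 1 1 (twinSwitchWeight y q)
      + switchedSum 1 x q 2 (-2) (twinSwitchWeight y q)
      + switchedSum 1 (x / 2) q 1 (-1) (twinSwitchWeight y q) with hFdef
  have hstep1 : |∑ q ∈ Icc 1 (x + 2), (if q ≤ z then F q else 0)| ≤ ∑ q ∈ Icc 1 z, |F q| := by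
    refine (abs_sum_le_sum_abs _ _).trans ?_
    have : ∑ q ∈ Icc 1 (x + 2), |(if q ≤ z then F q else 0)|
        = ∑ q ∈ (Icc 1 (x + 2)).filter (fun q => q ≤ z), |F q| := by
      rw [sum_filter]
      refine sum_congr rfl fun q _ => ?_
      split_ifs <;> simp
    rw [this]
    refine sum_le_sum_of_subset_of_nonneg ?_ fun _ _ _ => abs_nonneg _
    intro q hq
    rw [mem_filter, mem_Icc] at hq
    rw [mem_Icc]
    exact ⟨hq.1.1, hq.2⟩
  have hstep2 : ∑ q ∈ Icc 1 z, |F q|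
      ≤ ∑ q ∈ Icc 1 z, (|switchedSum 3 (x + 2) q 2 2 (twinSwitchWeight y q)|
          + |switchedSum 2 (x / 2 + 1) q 1 1 (twinSwitchWeight y q)|
          + |switchedSum 1 x q 2 (-2) (twinSwitchWeight y q)|
          + |switchedSum 1 (x / 2) q 1 (-1) (twinSwitchWeight y q)|) := by
    refine sum_le_sum fun q _ => ?_
    simp only [hFdef]
    exact (abs_add_le _ _).trans (add_le_add (abs_add_three _ _ _) le_rfl)
  have hLA : 0 < Real.log X ^ A := Real.rpow_pos_of_pos hLX0 _
  have hLxA : 0 < Real.log (x : ℝ) ^ A :=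
    Real.rpow_pos_of_pos (by linarith [two_le_log_of_nine_le hx9]) _
  have hconv : X / Real.log X ^ A ≤ 3 * x / Real.log (x : ℝ) ^ A := by
    have hlog : Real.log (x : ℝ) ≤ Real.log X := Real.log_le_log (by linarith) hxX
    have hpow : Real.log (x : ℝ) ^ A ≤ Real.log X ^ A :=
      Real.rpow_le_rpow (by linarith [two_le_log_of_nine_le hx9]) hlog hA.le
    calc X / Real.log X ^ A ≤ X / Real.log (x : ℝ) ^ A :=
          div_le_div_of_nonneg_left (by linarith) hLxA hpow
      _ ≤ 3 * x / Real.log (x : ℝ) ^ A := by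
          refine div_le_div_of_nonneg_right ?_ hLxA.le
          rw [hXdef]; linarith
  have hF : (fun q => if q ≤ z then F q else 0)
      = fun q => if q ≤ z then switchedSum 3 (x + 2) q 2 2 (twinSwitchWeight y q)
          + switchedSum 2 (x / 2 + 1) q 1 1 (twinSwitchWeight y q)
          + switchedSum 1 x q 2 (-2) (twinSwitchWeight y q)
          + switchedSum 1 (x / 2) q 1 (-1) (twinSwitchWeight y q) else 0 := by
    rfl
  rw [← hF]
  calc |∑ q ∈ Icc 1 (x + 2), (if q ≤ z then F q else 0)|
      ≤ ∑ q ∈ Icc 1 z, |F q| := hstep1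
    _ ≤ _ := hstep2
    _ = ∑ q ∈ Icc 1 z, |switchedSum 3 (x + 2) q 2 2 (twinSwitchWeight y q)|
        + ∑ q ∈ Icc 1 z, |switchedSum 2 (x / 2 + 1) q 1 1 (twinSwitchWeight y q)|
        + ∑ q ∈ Icc 1 z, |switchedSum 1 x q 2 (-2) (twinSwitchWeight y q)|
        + ∑ q ∈ Icc 1 z, |switchedSum 1 (x / 2) q 1 (-1) (twinSwitchWeight y q)| := by
        rw [sum_add_distrib, sum_add_distrib, sum_add_distrib]
    _ ≤ C₁ * X / Real.log X ^ A + C₂ * X / Real.log X ^ A + C₃ * X / Real.log X ^ A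
        + C₄ * X / Real.log X ^ A := add_le_add (add_le_add (add_le_add hS1 hS2) hS3) hS4
    _ = (C₁ + C₂ + C₃ + C₄) * (X / Real.log X ^ A) := by ring
    _ ≤ (C₁ + C₂ + C₃ + C₄) * (3 * x / Real.log (x : ℝ) ^ A) :=
        mul_le_mul_of_nonneg_left hconv (by positivity)
    _ = 3 * (C₁ + C₂ + C₃ + C₄) * x / Real.log (x : ℝ) ^ A := by ring

end Summit.Parity.BatemanHorn.Theorems
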